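import Mathlib
import Literature.Probability.Percolation.UnionJack
import Literature.Probability.Percolation.SiteEmbDomainCrossing
import Literature.Probability.Percolation.QuadCrossingSquareModel
import Literature.Probability.Percolation.SitePaths
import Literature.Probability.RandomPlanarGeometry.ChordalCurveFamily
import HarnessLib

/-!
# Stub `stub_crossMonoInner` (T2-inner) of line `registered`, crux `UnionJackBeffara.MixedInterpolation`

Helper file `--supports stmt-CriticalPhenomena-4559` (crux decl
`Summit.CriticalPhenomena.CardyFormulaZ2.Theses.UnionJackBeffara.MixedInterpolation`, skeleton v4
`Cruxes/MixedInterpolation/Lines/birth.lean`), proving EXACTLY the registered statement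
`Sig.stub_crossMonoInner` as `Registered.stub_crossMonoInner`: **monotonicity of the crude crossing event
under an inner bracket** (deterministic, model-free).

THE STATEMENT.  `R` is a conformal rectangle with square model `F` (`IsSquareModel R F`: the plane
homeomorphism `F` maps the open chart square `(-1,1)²` onto `R.carrier` and side `k` onto `R.arc k`), and
`R''` an inner bracket at scale `s > 0`: `R''.carrier ⊆ R.carrier ∪ F(|re| < 1-s, |im| ≥ 1)` and the arcs
`0` / `2` of `R''` lie in `F(|re| < 1-s, im < -1-s/32)` / `F(|re| < 1-s, im > 1+s/32)`.  Then for all small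
meshes `δ > 0` the crude `G_s`-crossing event of `R''` (an open site path of `δ·G_s` drawn in `R''.carrier`
from `2δ`-near `R''.arc 0` to `2δ`-near `R''.arc 2`) is contained in that of `R`.

THE PROOF (the index argument of the lead's design, Schramm–Smirnov's partial order "every crossing of the
larger quad contains a crossing of the smaller one", §1.3).  Let `τ` be a uniform-continuity modulus of
`F⁻¹` on a closed ball containing the `3`-neighbourhood of `closure R''` for `ε = min(s/32, 1)`, and let
`3δ < τ`, `δ ≤ 1`.  Edges of `δ·G_s` have length `≤ δ` (`dist_mesh_le`).  Read every site through its
chart height `h = im ∘ F⁻¹`: the start site is `2δ`-close to `R''.arc 0`, hence `h < -1`; the end site has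
`h > 1`.  Let `a'` be the FIRST site with `h ≥ 1` and `a` its predecessor (`PathIn.exit`), and on the initial
piece up to `a` let `b` be the LAST site with `h ≤ -1` and `b'` its successor (`PathIn.last_exit_or`; the
case `b = a` is excluded since an edge cannot join chart heights `≤ -1` and `≥ 1`).  The sites from `b'` to
`a` have `|h| < 1`, so they are drawn in `R.carrier` (points of `R'' ∖ R` have `|h| ≥ 1`); the segment
`[b, b']` is mapped by `F⁻¹` onto a connected set passing the height `-1` at a chart point of
`|re| < 1 - s + ε ≤ 1`, i.e. a point of the bottom side, so `b'` is within one edge (`≤ δ ≤ 2δ`) of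
`R.arc 0` (`infDist_arc_zero_le`); symmetrically `a` is within `2δ` of `R.arc 2`.

References: O. Schramm, S. Smirnov, *On the scaling limits of planar percolation*, Ann. Probab. 39 (2011),
§1.3 and §5 (proof of Lemma 5.1, square models) [SchrammSmirnov2011]; V. Beffara, *Is critical 2D
percolation universal?*, Progr. Probab. 60 (2008) §5.1 (the lattice `G_s`) [Beffara2008Universal].
-/

noncomputable section

namespace Summit.CriticalPhenomena.CardyFormulaZ2.Cruxes.MixedInterpolation.Registered

open Set Metric Filter Topology
open Literature.Probability.LatticeModels Literature.Probability.Percolation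
open Literature.Probability.RandomPlanarGeometry
open Literature.Barriers.CriticalPhenomena (MixedSite mixedParam)

/-! ### Edges of `G_s` in the covering-adapted embedding -/

/-- **Adjacent sites of `G_s` differ by a half-integer vector of sup-norm `≤ 1/2`**: in the coordinates
`2 · unionJackEmbed` an edge is a step `(±1, ±1)` (site–site) or `(±1, 0)`, `(0, ±1)` (site–centre).
[cite: Beffara2008Universal, §5.1] -/
theorem unionJackEmbed_sub_eq {y y' : MixedSite} (h : unionJackGraph.Adj y y') :
    ∃ m n : ℤ, |m| ≤ 1 ∧ |n| ≤ 1 ∧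
      unionJackEmbed y - unionJackEmbed y' = ((m : ℂ) + (n : ℂ) * Complex.I) / 2 := by
  cases y with
  | inl x =>
    cases y' with
    | inl x' =>
      rcases (unionJackGraph_adj_inl_inl x x').1 h with rfl | rfl | rfl | rfl
      · refine ⟨-1, 1, by norm_num, by norm_num, ?_⟩
        rw [unionJackEmbed_inl, unionJackEmbed_inl]; push_cast; ring
      · refine ⟨-1, -1, by norm_num, by norm_num, ?_⟩
        rw [unionJackEmbed_inl, unionJackEmbed_inl]; push_cast; ring
      · refine ⟨1, -1, by norm_num, by norm_num, ?_⟩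
        rw [unionJackEmbed_inl, unionJackEmbed_inl]; push_cast; ring
      · refine ⟨1, 1, by norm_num, by norm_num, ?_⟩
        rw [unionJackEmbed_inl, unionJackEmbed_inl]; push_cast; ring
    | inr f =>
      obtain ⟨h1, h2⟩ := (unionJackGraph_adj_inl_inr x f).1 h
      refine ⟨(x.1 + x.2) - (f.1 + f.2 + 1), (x.2 - x.1 + 1) - (f.2 + 1 - f.1), ?_, ?_, ?_⟩
      · rw [abs_le]; omega
      · rw [abs_le]; omega
      · rw [unionJackEmbed_inl, unionJackEmbed_inr]; push_cast; ring
  | inr f =>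
    cases y' with
    | inl x =>
      obtain ⟨h1, h2⟩ := (unionJackGraph_adj_inl_inr x f).1 h.symm
      refine ⟨(f.1 + f.2 + 1) - (x.1 + x.2), (f.2 + 1 - f.1) - (x.2 - x.1 + 1), ?_, ?_, ?_⟩
      · rw [abs_le]; omega
      · rw [abs_le]; omega
      · rw [unionJackEmbed_inl, unionJackEmbed_inr]; push_cast; ring
    | inr f' => exact absurd h (unionJackGraph_not_adj_inr_inr f f')

/-- **Edges of `G_s` have length `≤ 1`** in the covering-adapted embedding (in fact `1/√2` or `1/2`).
[cite: Beffara2008Universal, §5.1] -/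
theorem dist_unionJackEmbed_le {y y' : MixedSite} (h : unionJackGraph.Adj y y') :
    dist (unionJackEmbed y) (unionJackEmbed y') ≤ 1 := by
  obtain ⟨m, n, hm, hn, he⟩ := unionJackEmbed_sub_eq h
  rw [dist_eq_norm, he, norm_div, Complex.norm_two]
  have hm' : |(m : ℝ)| ≤ 1 := by exact_mod_cast hm
  have hn' : |(n : ℝ)| ≤ 1 := by exact_mod_cast hn
  have h1 : ‖(m : ℂ) + (n : ℂ) * Complex.I‖ ≤ 2 := by
    refine (Complex.norm_le_abs_re_add_abs_im _).trans ?_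
    have hre : ((m : ℂ) + (n : ℂ) * Complex.I).re = m := by simp
    have him : ((m : ℂ) + (n : ℂ) * Complex.I).im = n := by simp
    rw [hre, him]
    linarith
  linarith

/-- **Edges of `δ · G_s` have length `≤ δ`** (`δ ≥ 0`). [cite: Beffara2008Universal, §5.1] -/
theorem dist_mesh_le {δ : ℝ} (hδ : 0 ≤ δ) {y y' : MixedSite} (h : unionJackGraph.Adj y y') :
    dist ((δ : ℂ) * unionJackEmbed y) ((δ : ℂ) * unionJackEmbed y') ≤ δ := by
  rw [dist_eq_norm, ← mul_sub, norm_mul, Complex.norm_real, Real.norm_of_nonneg hδ, ← dist_eq_norm]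
  calc δ * dist (unionJackEmbed y) (unionJackEmbed y') ≤ δ * 1 := by
        gcongr; exact dist_unionJackEmbed_le h
    _ = δ := mul_one δ

/-! ### Reading points through the chart `F⁻¹` -/

/-- Nearby points have nearby imaginary parts. [folklore] -/
theorem abs_im_sub_lt {a b : ℂ} {ε : ℝ} (h : dist a b < ε) : |a.im - b.im| < ε := by
  rw [← Complex.sub_im]
  exact (Complex.abs_im_le_norm _).trans_lt (by rwa [← dist_eq_norm])

/-- Nearby points have nearby real parts. [folklore] -/
theorem abs_re_sub_lt {a b : ℂ} {ε : ℝ} (h : dist a b < ε) : |a.re - b.re| < ε := by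
  rw [← Complex.sub_re]
  exact (Complex.abs_re_le_norm _).trans_lt (by rwa [← dist_eq_norm])

/-- A point of an image `F '' S` pulls back into `S`. [folklore] -/
theorem symm_mem_of_mem_image {F : ℂ ≃ₜ ℂ} {S : Set ℂ} {x : ℂ} (h : x ∈ F '' S) : F.symm x ∈ S := by
  obtain ⟨p, hp, rfl⟩ := h
  rwa [Homeomorph.symm_apply_apply]

/-- **The domain in the chart**: `x ∈ R.carrier` iff `F⁻¹ x` lies in the open square `(-1,1)²`.
[cite: SchrammSmirnov2011, §5 (proof of Lemma 5.1)] -/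
theorem chart_mem_carrier_iff {R : ConformalRectangle} {F : ℂ ≃ₜ ℂ} (hF : IsSquareModel R F) {x : ℂ} :
    x ∈ R.carrier ↔ |(F.symm x).re| < 1 ∧ |(F.symm x).im| < 1 := by
  rw [← hF.image_carrier, Homeomorph.image_eq_preimage_symm, mem_preimage, unitSquareQuad_carrier,
    Complex.mem_reProdIm, mem_Ioo, mem_Ioo, abs_lt, abs_lt]

/-- A point of the inner bracket of chart height `|im| ≥ 1` lies in the narrow extension: its chart
abscissa satisfies `|re| < 1 - s`. [cite: SchrammSmirnov2011, §5 (proof of Lemma 5.1)] -/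
theorem chart_abs_re_lt {R R'' : ConformalRectangle} {F : ℂ ≃ₜ ℂ} (hF : IsSquareModel R F) {s : ℝ}
    (hN1 : R''.carrier ⊆ R.carrier ∪ F '' {p : ℂ | |p.re| < 1 - s ∧ 1 ≤ |p.im|})
    {x : ℂ} (hx : x ∈ R''.carrier) (him : 1 ≤ |(F.symm x).im|) : |(F.symm x).re| < 1 - s := by
  rcases hN1 hx with h | h
  · exact absurd ((chart_mem_carrier_iff hF).1 h).2 (not_lt.2 him)
  · exact (symm_mem_of_mem_image h).1

/-- A point of the inner bracket of chart height `|im| < 1` lies in `R.carrier`.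
[cite: SchrammSmirnov2011, §5 (proof of Lemma 5.1)] -/
theorem chart_mem_carrier {R R'' : ConformalRectangle} {F : ℂ ≃ₜ ℂ} {s : ℝ}
    (hN1 : R''.carrier ⊆ R.carrier ∪ F '' {p : ℂ | |p.re| < 1 - s ∧ 1 ≤ |p.im|})
    {x : ℂ} (hx : x ∈ R''.carrier) (him : |(F.symm x).im| < 1) : x ∈ R.carrier := by
  rcases hN1 hx with h | h
  · exact h
  · exact absurd (symm_mem_of_mem_image h).2 (not_le.2 him)

/-- **Intermediate values on a segment**: a continuous real function passes every value between its
values at the endpoints somewhere on the segment. [folklore] -/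
theorem exists_mem_segment_eq {f : ℂ → ℝ} (hf : Continuous f) {x y : ℂ} {c : ℝ} (hx : f x ≤ c)
    (hy : c ≤ f y) : ∃ p ∈ segment ℝ x y, f p = c :=
  (convex_segment x y).isPreconnected.intermediate_value (left_mem_segment ℝ x y)
    (right_mem_segment ℝ x y) hf.continuousOn ⟨hx, hy⟩

/-- **Nearest arc point in the chart**: if `x` is `r`-close to a nonempty compact `A`, `r < τ`, and `τ` is a
uniform-continuity modulus of `F⁻¹` on `K ⊇ A ∪ {x}` for `ε`, then some point of `A` is `ε`-close to `x`
in the chart. [folklore] -/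
theorem exists_near_chart {A K : Set ℂ} (hAc : IsCompact A) (hAn : A.Nonempty) {F : ℂ ≃ₜ ℂ} {ε τ : ℝ}
    (hUC : ∀ x ∈ K, ∀ y ∈ K, dist x y < τ → dist (F.symm x) (F.symm y) < ε)
    {x : ℂ} (hx : x ∈ K) (hAK : ∀ q ∈ A, q ∈ K) {r : ℝ} (hr : infDist x A ≤ r) (hrτ : r < τ) :
    ∃ q ∈ A, dist (F.symm x) (F.symm q) < ε := by
  obtain ⟨q, hq, hd⟩ := hAc.exists_infDist_eq_dist hAn x
  exact ⟨q, hq, hUC x hx q (hAK q hq) (by rw [← hd]; exact hr.trans_lt hrτ)⟩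

/-- **Entering across the bottom arc.**  Let `x ∈ R''.carrier` have chart height `≤ -1` and `y` chart
height `≥ -1`, with `dist x y < τ` (`τ` a modulus of `F⁻¹` for `ε ≤ s` on a set `K` containing the
`dist x y`-ball about `x`).  Then the segment `[x, y]` meets `R.arc 0 = F([-1,1] × {-1})` — at a point of
chart height `-1` (intermediate values) and chart abscissa `|re| < 1 - s + ε ≤ 1` — so `y` is within
`dist x y` of `R.arc 0`. [cite: SchrammSmirnov2011, §1.3] -/
theorem infDist_arc_zero_le {R R'' : ConformalRectangle} {F : ℂ ≃ₜ ℂ} (hF : IsSquareModel R F) {s : ℝ}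
    (hN1 : R''.carrier ⊆ R.carrier ∪ F '' {p : ℂ | |p.re| < 1 - s ∧ 1 ≤ |p.im|})
    {K : Set ℂ} {ε τ : ℝ} (hεs : ε ≤ s)
    (hUC : ∀ x ∈ K, ∀ y ∈ K, dist x y < τ → dist (F.symm x) (F.symm y) < ε)
    {x y : ℂ} (hx : x ∈ R''.carrier) (hxim : (F.symm x).im ≤ -1) (hyim : -1 ≤ (F.symm y).im)
    (hK : ∀ p : ℂ, dist x p ≤ dist x y → p ∈ K) (hxy : dist x y < τ) :
    infDist y (R.arc 0) ≤ dist x y := by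
  obtain ⟨p, hp, hpc⟩ := exists_mem_segment_eq (f := fun z => (F.symm z).im)
    (Complex.continuous_im.comp F.symm.continuous) hxim hyim
  have hsum := dist_add_dist_of_mem_segment hp
  have hxp : dist x p ≤ dist x y := by linarith [dist_nonneg (x := p) (y := y)]
  have hpy : dist p y ≤ dist x y := by linarith [dist_nonneg (x := x) (y := p)]
  have hre : |(F.symm x).re| < 1 - s :=
    chart_abs_re_lt hF hN1 hx (le_abs.2 (Or.inr (by linarith)))
  have hd : dist (F.symm x) (F.symm p) < ε :=
    hUC x (hK x (by rw [dist_self]; exact dist_nonneg)) p (hK p hxp) (hxp.trans_lt hxy)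
  have hre' := abs_re_sub_lt hd
  have hp1 : |(F.symm p).re| ≤ 1 := by
    have := abs_sub_abs_le_abs_sub (F.symm p).re (F.symm x).re
    rw [abs_sub_comm] at hre'
    linarith
  have hparc : F.symm p ∈ unitSquareQuad.arc 0 := SquareModel.mem_arc_zero.2 ⟨hpc, abs_le.1 hp1⟩
  have hpR : p ∈ R.arc 0 := by
    rw [← hF.image_arc 0]
    exact ⟨F.symm p, hparc, F.apply_symm_apply p⟩
  calc infDist y (R.arc 0) ≤ dist y p := infDist_le_dist_of_mem hpR
    _ = dist p y := dist_comm _ _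
    _ ≤ dist x y := hpy

/-- **Leaving across the top arc** (the statement symmetric to `infDist_arc_zero_le`): if `x ∈ R''.carrier`
has chart height `≥ 1` and `y` chart height `≤ 1`, `dist x y < τ`, then `y` is within `dist x y` of
`R.arc 2 = F([-1,1] × {1})`. [cite: SchrammSmirnov2011, §1.3] -/
theorem infDist_arc_two_le {R R'' : ConformalRectangle} {F : ℂ ≃ₜ ℂ} (hF : IsSquareModel R F) {s : ℝ}
    (hN1 : R''.carrier ⊆ R.carrier ∪ F '' {p : ℂ | |p.re| < 1 - s ∧ 1 ≤ |p.im|})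
    {K : Set ℂ} {ε τ : ℝ} (hεs : ε ≤ s)
    (hUC : ∀ x ∈ K, ∀ y ∈ K, dist x y < τ → dist (F.symm x) (F.symm y) < ε)
    {x y : ℂ} (hx : x ∈ R''.carrier) (hxim : 1 ≤ (F.symm x).im) (hyim : (F.symm y).im ≤ 1)
    (hK : ∀ p : ℂ, dist x p ≤ dist x y → p ∈ K) (hxy : dist x y < τ) :
    infDist y (R.arc 2) ≤ dist x y := by
  obtain ⟨p, hp, hpc⟩ := exists_mem_segment_eq (f := fun z => -(F.symm z).im) (c := -1)
    (Complex.continuous_im.comp F.symm.continuous).neg (by simpa using hxim) (by simpa using hyim)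
  have hpc' : (F.symm p).im = 1 := by simpa using hpc
  have hsum := dist_add_dist_of_mem_segment hp
  have hxp : dist x p ≤ dist x y := by linarith [dist_nonneg (x := p) (y := y)]
  have hpy : dist p y ≤ dist x y := by linarith [dist_nonneg (x := x) (y := p)]
  have hre : |(F.symm x).re| < 1 - s :=
    chart_abs_re_lt hF hN1 hx (le_abs.2 (Or.inl hxim))
  have hd : dist (F.symm x) (F.symm p) < ε :=
    hUC x (hK x (by rw [dist_self]; exact dist_nonneg)) p (hK p hxp) (hxp.trans_lt hxy)
  have hre' := abs_re_sub_lt hd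
  have hp1 : |(F.symm p).re| ≤ 1 := by
    have := abs_sub_abs_le_abs_sub (F.symm p).re (F.symm x).re
    rw [abs_sub_comm] at hre'
    linarith
  have hparc : F.symm p ∈ unitSquareQuad.arc 2 := SquareModel.mem_arc_two.2 ⟨hpc', abs_le.1 hp1⟩
  have hpR : p ∈ R.arc 2 := by
    rw [← hF.image_arc 2]
    exact ⟨F.symm p, hparc, F.apply_symm_apply p⟩
  calc infDist y (R.arc 2) ≤ dist y p := infDist_le_dist_of_mem hpR
    _ = dist p y := dist_comm _ _
    _ ≤ dist x y := hpy

/-! ### The stub -/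

/-- **Stub T2-inner — monotonicity of the crude crossing event under an inner bracket** (registered
signature `Sig.stub_crossMonoInner` of the skeleton, verbatim).  If `R'' ⊆ R ∪ F(|re|<1-s, |im|≥1)` and the
arcs 0/2 of `R''` lie strictly below/above the closed chart square, then for all small `δ` every open
`G_s`-path realising `cross_δ(R'')` contains a sub-path realising `cross_δ(R)`: with `a'` the first site of
chart height `≥ 1` and `b` the last site before it of height `≤ -1`, the sites strictly between lie in `R`
(heights in `(-1,1)`), the edge `b b'` (length `≤ δ`) crosses `F([-1,1] × {-1}) = R.arc 0` at chart
`|re| ≤ 1 - s + ε` (uniform continuity of `F⁻¹` on a compact), so `b'` is within `2δ` of `R.arc 0`; idem at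
the top. [cite: SchrammSmirnov2011, §1.3] -/
theorem stub_crossMonoInner :
    ∀ (R R'' : Literature.Probability.RandomPlanarGeometry.ConformalRectangle) (F : ℂ ≃ₜ ℂ), Literature.Probability.Percolation.IsSquareModel R F →
      ∀ s : ℝ, 0 < s →
        R''.carrier ⊆ R.carrier ∪ F '' {p : ℂ | |p.re| < 1 - s ∧ 1 ≤ |p.im|} →
        R''.arc 0 ⊆ F '' {p : ℂ | |p.re| < 1 - s ∧ p.im < -1 - s / 32} →
        R''.arc 2 ⊆ F '' {p : ℂ | |p.re| < 1 - s ∧ 1 + s / 32 < p.im} →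
        ∀ᶠ δ : ℝ in nhdsWithin 0 (Set.Ioi 0),
          siteEmbDomainCrossing unionJackGraph unionJackEmbed R''.carrier δ (R''.arc 0) (R''.arc 2) ⊆
            siteEmbDomainCrossing unionJackGraph unionJackEmbed R.carrier δ (R.arc 0) (R.arc 2) := by
  intro R R'' F hF s hs hN1 hN2a hN2b
  -- a compact ball `K` around `closure R''` and a uniform-continuity modulus `τ` of `F⁻¹` on it
  obtain ⟨ρ, hρ⟩ := R''.isBounded.closure.subset_closedBall (0 : ℂ)
  have hKc : IsCompact (closedBall (0 : ℂ) (ρ + 3)) := isCompact_closedBall 0 (ρ + 3)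
  have hK : ∀ x ∈ closure R''.carrier, ∀ p : ℂ, dist x p ≤ 3 → p ∈ closedBall (0 : ℂ) (ρ + 3) := by
    intro x hx p hp
    have hx' := hρ hx
    rw [mem_closedBall] at hx' ⊢
    linarith [dist_triangle p x 0, dist_comm x p]
  have hε : 0 < min (s / 32) 1 := lt_min (by positivity) one_pos
  have hε32 : min (s / 32) 1 ≤ s / 32 := min_le_left _ _
  have hε1 : min (s / 32) 1 ≤ 1 := min_le_right _ _
  have hεs : min (s / 32) 1 ≤ s := hε32.trans (by linarith)
  obtain ⟨τ, hτ, hUC⟩ := Metric.uniformContinuousOn_iff.1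
    (hKc.uniformContinuousOn_of_continuous F.symm.continuous.continuousOn) _ hε
  have h3 : (0 : ℝ) < min 1 (τ / 3) := lt_min one_pos (by positivity)
  filter_upwards [Ioo_mem_nhdsGT h3] with δ hδ
  obtain ⟨hδ0, hδ'⟩ := hδ
  have hδ1 : δ ≤ 1 := hδ'.le.trans (min_le_left _ _)
  have hδτ : 3 * δ < τ := by
    have := hδ'.trans_le (min_le_right _ _)
    linarith
  -- the sites of the window of `R''` and everything within `δ` of them are in `K`
  have hWK : ∀ y : MixedSite, (δ : ℂ) * unionJackEmbed y ∈ R''.carrier → ∀ p : ℂ,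
      dist ((δ : ℂ) * unionJackEmbed y) p ≤ δ → p ∈ closedBall (0 : ℂ) (ρ + 3) :=
    fun y hy p hp => hK _ (subset_closure hy) p (hp.trans (by linarith))
  have hAK : ∀ k : Fin 4, ∀ q ∈ R''.arc k, q ∈ closedBall (0 : ℂ) (ρ + 3) := fun k q hq =>
    hK q (frontier_subset_closure (R''.arc_subset_frontier k hq)) q (by rw [dist_self]; norm_num)
  intro ω hω
  rw [mem_siteEmbDomainCrossing_iff] at hω ⊢
  obtain ⟨u, v, hu, hv, hω⟩ := hω
  have hp := PathIn.of_mem_siteConnIn hω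
  -- the endpoints in the chart: `u` below height `-1`, `v` above height `1`
  have huim : (F.symm ((δ : ℂ) * unionJackEmbed u)).im < -1 := by
    obtain ⟨q, hq, hd⟩ := exists_near_chart (R''.isCompact_arc 0) ⟨_, R''.pt_mem_arc_self 0⟩ hUC
      (hWK u hp.left_mem.1 _ (by rw [dist_self]; exact hδ0.le)) (hAK 0) hu (by linarith)
    obtain ⟨p, hp', rfl⟩ := hN2a hq
    rw [Homeomorph.symm_apply_apply] at hd
    have h := abs_im_sub_lt hd
    rw [abs_lt] at h
    linarith [hp'.2]
  have hvim : 1 < (F.symm ((δ : ℂ) * unionJackEmbed v)).im := by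
    obtain ⟨q, hq, hd⟩ := exists_near_chart (R''.isCompact_arc 2) ⟨_, R''.pt_mem_arc_self 2⟩ hUC
      (hWK v hp.right_mem.1 _ (by rw [dist_self]; exact hδ0.le)) (hAK 2) hv (by linarith)
    obtain ⟨p, hp', rfl⟩ := hN2b hq
    rw [Homeomorph.symm_apply_apply] at hd
    have h := abs_im_sub_lt hd
    rw [abs_lt] at h
    linarith [hp'.2]
  -- `a'`: the first site of chart height `≥ 1`, `a` its predecessor
  obtain ⟨a, a', haR, ha'R, ha'A, haa', hpa⟩ := hp.exit
    (R := {y : MixedSite | (F.symm ((δ : ℂ) * unionJackEmbed y)).im < 1})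
    (show (F.symm ((δ : ℂ) * unionJackEmbed u)).im < 1 by linarith)
    (show ¬ (F.symm ((δ : ℂ) * unionJackEmbed v)).im < 1 from not_lt.2 hvim.le)
  have haW : (δ : ℂ) * unionJackEmbed a ∈ R''.carrier := hpa.right_mem.2.1
  have ha'W : (δ : ℂ) * unionJackEmbed a' ∈ R''.carrier := ha'A.1
  have ha'im : 1 ≤ (F.symm ((δ : ℂ) * unionJackEmbed a')).im := not_lt.1 ha'R
  have haim : (F.symm ((δ : ℂ) * unionJackEmbed a)).im < 1 := haR
  -- `b`: the last site of height `≤ -1` before `a'`, `b'` its successor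
  rcases hpa.last_exit_or (C := {y : MixedSite | (F.symm ((δ : ℂ) * unionJackEmbed y)).im ≤ -1})
    (show (F.symm ((δ : ℂ) * unionJackEmbed u)).im ≤ -1 from huim.le) with haC | ⟨b, b', hbC, hbA, hb'C, hbb', hpb⟩
  · -- `b = a`: the edge `a a'` would join chart heights `≤ -1` and `≥ 1`
    exfalso
    have haC' : (F.symm ((δ : ℂ) * unionJackEmbed a)).im ≤ -1 := haC
    have hdist := dist_mesh_le hδ0.le haa'
    have hd := hUC _ (hWK a haW _ (by rw [dist_self]; exact hδ0.le)) _ (hWK a haW _ hdist)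
      (hdist.trans_lt (by linarith))
    have h := abs_im_sub_lt hd
    rw [abs_lt] at h
    linarith
  · -- the piece from `b'` to `a` is an open crude crossing of `R`
    have hbW : (δ : ℂ) * unionJackEmbed b ∈ R''.carrier := hbA.2.1
    have hbim : (F.symm ((δ : ℂ) * unionJackEmbed b)).im ≤ -1 := hbC
    have hb'im : -1 < (F.symm ((δ : ℂ) * unionJackEmbed b')).im := not_le.1 hb'C
    refine ⟨b', a, ?_, ?_, ?_⟩
    · have hdist := dist_mesh_le hδ0.le hbb'
      calc infDist ((δ : ℂ) * unionJackEmbed b') (R.arc 0)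
          ≤ dist ((δ : ℂ) * unionJackEmbed b) ((δ : ℂ) * unionJackEmbed b') :=
            infDist_arc_zero_le hF hN1 hεs hUC hbW hbim hb'im.le
              (fun p hp' => hWK b hbW p (hp'.trans hdist)) (hdist.trans_lt (by linarith))
        _ ≤ 2 * δ := hdist.trans (by linarith)
    · have hdist := dist_mesh_le hδ0.le haa'.symm
      calc infDist ((δ : ℂ) * unionJackEmbed a) (R.arc 2)
          ≤ dist ((δ : ℂ) * unionJackEmbed a') ((δ : ℂ) * unionJackEmbed a) :=
            infDist_arc_two_le hF hN1 hεs hUC ha'W ha'im haim.le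
              (fun p hp' => hWK a' ha'W p (hp'.trans hdist)) (hdist.trans_lt (by linarith))
        _ ≤ 2 * δ := hdist.trans (by linarith)
    · refine (hpb.mono fun y hy => ?_).mem_siteConnIn
      obtain ⟨⟨hy1, hy2, hy3⟩, hy4⟩ := hy
      have hy1' : (F.symm ((δ : ℂ) * unionJackEmbed y)).im < 1 := hy1
      have hy4' : ¬ (F.symm ((δ : ℂ) * unionJackEmbed y)).im ≤ -1 := hy4
      exact ⟨chart_mem_carrier hN1 hy2 (abs_lt.2 ⟨not_le.1 hy4', hy1'⟩), hy3⟩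

end Summit.CriticalPhenomena.CardyFormulaZ2.Cruxes.MixedInterpolation.Registered

end
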